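import Summits.QuantumFields.QCD.Cruxes.SpinWaveLaws.Lines.birth

/-!
# Strategist sketch (cstrat r1) — candidate FIRST RUNGS of `SpinWaveLaws` (BC5 plan-only material)

Stated over the birth skeleton's currency (`pcmExpect`, `pcmMeasure`, `torusDist`, `transverse`, `SU`).
Nothing here is filed as an item; these are the signatures quoted in STRATEGY-CENSUS.md §Rungs.
-/

noncomputable section

namespace Summit.QuantumFields.QCD.Cruxes.SpinWaveLaws.Strategist

open scoped BigOperators
open MeasureTheory
open Literature.Probability.LatticeModels (TorusSite)
open Summit.QuantumFields.QCD.Cruxes.SpinWaveLaws.Birth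

/-- **Rung R1 (massive corner, single scale).** Fix the spin-wave mass `m² = h/β` and send `β → ∞`
ALONG `h = β m²`: exponential clustering of bounded cylinder observables at rate `c·m`, uniformly in the
volume, with constants allowed to depend on `m`.  This is the one-scale shadow of the upper law (the
crux asks for the same with constants UNIFORM in `m → 0⁺`, which is the multiscale content); it lies
outside the crux's own parameter box (`h ≤ h₀`) but exercises exactly the lever (massive spin waves of
mass² `h/β`).  Technique: low-temperature cluster expansion about the massive Gaussian
(Bricmont–Fontaine–Lebowitz–Lieb–Spencer 1980/81 format; Bałaban's small-field step without iteration). -/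
def MassiveCornerClustering (N : ℕ) : Prop :=
  ∀ m : ℝ, 0 < m → m ≤ 1 → ∃ β₀ c : ℝ, 0 < β₀ ∧ 0 < c ∧ ∃ (K : ℕ → ℕ → ℝ) (L₀ : ℕ),
    ∀ β : ℝ, β₀ ≤ β → ∀ (L : ℕ) [NeZero L], L₀ ≤ L →
      ∀ (A B : Finset (TorusSite 4 L)) (F F' : (TorusSite 4 L → SU N) → ℝ),
        (∀ g g', (∀ x ∈ A, g x = g' x) → F g = F g') → (∀ g g', (∀ x ∈ B, g x = g' x) → F' g = F' g') →
          Measurable F → Measurable F' → (∀ g, |F g| ≤ 1) → (∀ g, |F' g| ≤ 1) →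
            ∀ R : ℕ, (∀ a ∈ A, ∀ b ∈ B, R ≤ torusDist a b) →
              |pcmExpect N β (β * m ^ 2) L (fun g => F g * F' g) -
                  pcmExpect N β (β * m ^ 2) L F * pcmExpect N β (β * m ^ 2) L F'| ≤
                K A.card B.card * Real.exp (-(c * m * R))

/-- **Rung R2 (transverse positivity, `N = 2`).** For the SU(2) = S³ model (the O(4) vector model with
coupling `2β` and field `2h` along `s⁰ = Re g₀₀`), the transverse two-point function of `u = Im g₀₁`
(a Cartesian coordinate of the unit quaternion) is NON-NEGATIVE at every pair of sites, every `β, h ≥ 0`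
and every volume — Griffiths' first inequality (expand the Boltzmann factor; odd moments of the uniform
measure on S³ vanish, even ones are ≥ 0).  The sign half of the lower law, with no rate. -/
def TransversePositivitySU2 : Prop :=
  ∀ (β h : ℝ), 0 ≤ β → 0 ≤ h → ∀ (L : ℕ) [NeZero L], ∀ x y : TorusSite 4 L,
    0 ≤ pcmExpect 2 β h L (fun g => transverse (N := 2) le_rfl (g x) * transverse (N := 2) le_rfl (g y))

/-- **Rung R3 (the Gaussian spin-wave toy model).** Two-sided bounds for the massive lattice Green's
function on the torus `(ℤ/L)⁴`, `G = (−Δ + m²)⁻¹`: `G(0,y) ≤ K (e^{−c m |y|} + 1/(L⁴ m²))` for all `y`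
(the second term is the torus zero mode `k = 0`, which dominates when `mL ≪ 1` — in the crux itself that
regime is absorbed by the compactness of the spins, `|Cov| ≤ 2`), and `G(0,y) ≥ c' (1+|y|)⁻² e^{−C m |y|}`
for `4|y| ≤ L`, uniformly in `L ≥ L₀` and `0 < m ≤ 1` — the tree level of BOTH laws
(`Cov(u₀,u_y) ≈ G(0,y)/(2β)` with `m² = h/β`).  Pure lattice analysis (random-walk / image-sum
representation or Fourier series on the torus); provable now. Stated abstractly over a kernel `G`
characterised as the inverse of `−Δ + m²` on the torus (sup-norm distance `torusDist`). -/
def GaussianSpinWaveToy : Prop :=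
  ∃ (c C c' K : ℝ) (L₀ : ℕ), 0 < c ∧ 0 < C ∧ 0 < c' ∧ 0 < K ∧
    ∀ m : ℝ, 0 < m → m ≤ 1 → ∀ (L : ℕ) [NeZero L], L₀ ≤ L →
      ∀ G : TorusSite 4 L → TorusSite 4 L → ℝ,
        (∀ x z : TorusSite 4 L,
            ((2 * 4 : ℝ) + m ^ 2) * G x z - ∑ i : Fin 4, (G (x + Pi.single i 1) z + G (x - Pi.single i 1) z) =
              if x = z then 1 else 0) →
          (∀ y : TorusSite 4 L, G 0 y ≤ K * (Real.exp (-(c * m * torusDist 0 y)) + 1 / ((L : ℝ) ^ 4 * m ^ 2))) ∧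
          (∀ y : TorusSite 4 L, 4 * torusDist 0 y ≤ L →
              c' / ((1 : ℝ) + torusDist 0 y) ^ 2 * Real.exp (-(C * m * torusDist 0 y)) ≤ G 0 y)

end Summit.QuantumFields.QCD.Cruxes.SpinWaveLaws.Strategist

end
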